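import Mathlib
import HarnessLib
import Summits.CriticalPhenomena.PercolationContinuityZ3.Theses.PercTreeValue
import Summits.CriticalPhenomena.PercolationContinuityZ3.Theorems.PercTreeValueTetrahedronDisjointCoexistenceStubPairSymm
import Literature.Probability.Percolation.HalfSpaceProofs
import Literature.Probability.Percolation.ConstrainedClusters
import Literature.Probability.Percolation.BondPercolationSymmetry
import Literature.Probability.Percolation.RSW
import Literature.Probability.Percolation.TwoPointFunction
import Literature.Probability.LatticeModels.LatticeGraphProofs

/-!
# `stub_twoReplicaOfConfinement` of line `SketchIdeator2` (crux `TetrahedronDisjointCoexistence`,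
# stmt-CriticalPhenomena-7798): confinement positivity ⇒ two-replica non-intersection

Registered stub `stub_twoReplicaOfConfinement` (S8) of the lead's skeleton
`Cruxes/TetrahedronDisjointCoexistence/Lines/SketchIdeator2.lean`, landed DEF-FREE over tree
declarations.

With `a_r = (r,r,0)`, `b_r = (r,0,r)`, `c_r = (0,r,r)` in `ℤ³`, `H_r = {x | 2x₂ + 2 ≤ r}`,
`U_r = {x | r + 2 ≤ 2x₂}`, `Conf(R; x, y) = {ω | y ∈ C_ω(x) ∧ C_ω(x) ⊆ R}` and
`P = bondPercolation (zdGraph 3) p_c`: if `P(Conf(H_r; 0, a_r)) ≥ c τ(0, a_r)` for `r ≥ r₀`, then two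
INDEPENDENT critical configurations satisfy `a_r ∈ C₁(0)`, `c_r ∈ C₂(b_r)`, `C₂(b_r)` finite and
`C₁(0) ∩ C₂(b_r) = ∅` with probability at least `c² τ(0, a_r) τ(b_r, c_r)` (`r ≥ r₀`).

Proof. The rectangle `Conf(H_r; 0, a_r) ×ˢ (Conf(U_r; b_r, c_r) ∩ {C(b_r) finite})` lies in the
two-replica event (`H_r ∩ U_r = ∅`), and its `P ⊗ P`-probability is the product of the factors
(`measureReal_prod_prod`). The finiteness conjunct is almost sure: a.s. no INFINITE open cluster of
`ℤ³` at `p_c` is confined to an upper half-space `{x | m ≤ x₂}` — its lowest vertex `y` would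
percolate inside the half-space `{x | y₂ ≤ x₂}` through its boundary point `y`, an event of
probability `θ_ℍ(p_c) = 0` (Barsky–Grimmett–Newman, `BarskyGrimmettNewman1991_Z3_holds`, read on the
ambient configuration space by `theta_induce_eq_real_percolatesVia` and transported from
`(0, {0 ≤ x₀})` to `(y, {y₂ ≤ x₂})` by a lattice automorphism,
`bondPercolation_real_preimage_relabel_iso`); there are countably many `y`. Finally
`P(Conf(U_r; b_r, c_r)) = P(Conf(H_r; 0, a_r))` and `τ(b_r, c_r) = τ(0, a_r)` (`stub_pairSymm`), so the
product is `P(Conf(H_r; 0, a_r))² ≥ (c τ(0, a_r))² = c² τ(0, a_r) τ(b_r, c_r)`.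
-/

noncomputable section

namespace Summit.CriticalPhenomena.PercolationContinuityZ3.Theorems.TetrahedronDisjointCoexistence

open MeasureTheory
open Literature.Probability.Percolation Literature.Probability.LatticeModels

/-- A whole open cluster confined to `W` is reached inside `W`: if `ω` opens only edges of `G` and
`C_ω(x) ⊆ W`, then `C_ω(x)` is contained in the cluster of `x` using only steps of `G` inside `W`
(every edge of an open walk from `x` is an edge of `G` with both endpoints in `C_ω(x) ⊆ W`). -/
theorem tROC_openCluster_subset_openClusterIn {V : Type*} {G : SimpleGraph V} {ω : BondConfig V}
    (hω : ω ⊆ G.edgeSet) {W : Set V} {x : V} (hW : openCluster ω x ⊆ W) :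
    openCluster ω x ⊆ openClusterIn (withinGraph G W) ω x := by
  -- every open walk starting inside `C(x)` is a walk of `openGraph ω ⊓ withinGraph G W`
  suffices h : ∀ (u v : V) (w : (openGraph ω).Walk u v), u ∈ openCluster ω x →
      (openGraph ω ⊓ withinGraph G W).Reachable u v by
    intro y hy
    obtain ⟨w⟩ := (show (openGraph ω).Reachable x y from hy)
    exact mem_openClusterIn_iff.2 (h x y w (mem_openCluster_self ω x))
  intro u v w
  induction w with
  | nil => exact fun _ => SimpleGraph.Reachable.refl _
  | @cons a b _ hab _ ih =>
    intro ha
    have hb : b ∈ openCluster ω x :=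
      (show (openGraph ω).Reachable x a from ha).trans hab.reachable
    have hab' : (openGraph ω ⊓ withinGraph G W).Adj a b := by
      rw [SimpleGraph.inf_adj, withinGraph_adj]
      exact ⟨hab, (SimpleGraph.mem_edgeSet G).1 (hω ((openGraph_adj ω a b).1 hab).1), hW ha,
        hW hb⟩
    exact hab'.reachable.trans (ih hb)

/-- **Barsky–Grimmett–Newman at every boundary point of every upper half-space.** For `y ∈ ℤ³`,
`P_{p_c}(y ↔ ∞ in {x | y₂ ≤ x₂}) = 0`: the automorphism `ψ(x) = (x₁ + y₀, x₂ + y₁, x₀ + y₂)` of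
`ℤ³` carries `0` to `y` and the half-space `{0 ≤ x₀}` onto `{y₂ ≤ x₂}`, bond percolation is
automorphism invariant (`bondPercolation_real_preimage_relabel_iso`), and
`P_{p_c}(0 ↔ ∞ in {0 ≤ x₀}) = θ_ℍ(p_c) = 0` (`theta_induce_eq_real_percolatesVia`,
`BarskyGrimmettNewman1991_Z3_holds`). -/
theorem tROC_real_percolatesVia_halfSpace_eq_zero (y : Site 3) :
    (bondPercolation (zdGraph 3) (criticalProbI 3)).real
        (percolatesVia (withinGraph (zdGraph 3) {x : Site 3 | y 2 ≤ x 2}) y) = 0 := by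
  -- `ℓ¹` characterisation of adjacency in `ℤ³`
  have hadj : ∀ x y : Site 3, (zdGraph 3).Adj x y ↔ ∑ i, |x i - y i| = 1 :=
    zdGraph_adj_iff_norm_holds
  -- the automorphism `ψ(x) = (x₁ + y₀, x₂ + y₁, x₀ + y₂)` of `ℤ³`
  let ψ : zdGraph 3 ≃g zdGraph 3 :=
    { toFun := fun x => ![x 1 + y 0, x 2 + y 1, x 0 + y 2]
      invFun := fun x' => ![x' 2 - y 2, x' 0 - y 0, x' 1 - y 1]
      left_inv := fun x => by
        funext i
        fin_cases i <;> simp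
      right_inv := fun x' => by
        funext i
        fin_cases i <;> simp
      map_rel_iff' := fun {a b} => by
        simp only [Equiv.coe_fn_mk, hadj, Fin.sum_univ_three, Matrix.cons_val_zero,
          Matrix.cons_val_one, Matrix.head_cons, Matrix.cons_val_two, Matrix.tail_cons,
          add_sub_add_right_eq_sub]
        constructor <;> intro h <;> linarith }
  have hψ : ∀ x : Site 3, ψ x = ![x 1 + y 0, x 2 + y 1, x 0 + y 2] := fun x => rfl
  have hψ0 : ψ 0 = y := by
    rw [hψ]
    funext i
    fin_cases i <;> simp
  -- `ψ` carries the steps inside `{0 ≤ x₀}` onto the steps inside `{y₂ ≤ x₂}`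
  have hK : ∀ u v : Site 3,
      (withinGraph (zdGraph 3) {x : Site 3 | y 2 ≤ x 2}).Adj (ψ.toEquiv u) (ψ.toEquiv v) ↔
        (withinGraph (zdGraph 3) {x : Site 3 | 0 ≤ x 0}).Adj u v := by
    intro u v
    rw [withinGraph_adj, withinGraph_adj, RelIso.coe_fn_toEquiv, SimpleGraph.Iso.map_adj_iff ψ]
    simp only [Set.mem_setOf_eq, hψ, Matrix.cons_val_two, Matrix.tail_cons, Matrix.head_cons,
      le_add_iff_nonneg_left]
  -- Barsky–Grimmett–Newman on the ambient configuration space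
  have hBGN : theta ((zdGraph 3).induce {x : Site 3 | 0 ≤ x 0}) ⟨0, Set.mem_setOf.mpr le_rfl⟩
      (criticalProbI 3) = 0 := BarskyGrimmettNewman1991_Z3_holds
  rw [theta_induce_eq_real_percolatesVia (zdGraph 3) {x : Site 3 | 0 ≤ x 0} 0
    (Set.mem_setOf.mpr le_rfl) (criticalProbI 3)] at hBGN
  -- transport along `ψ`
  have h1 := relabel_preimage_percolatesVia ψ.toEquiv hK (0 : Site 3)
  rw [RelIso.coe_fn_toEquiv, hψ0] at h1
  have h2 := bondPercolation_real_preimage_relabel_iso ψ (criticalProbI 3)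
    (percolatesVia (withinGraph (zdGraph 3) {x : Site 3 | y 2 ≤ x 2}) y)
  rw [h1] at h2
  rw [← h2]
  exact hBGN

/-- **Almost surely, no infinite open cluster of `ℤ³` at `p_c` is confined to an upper half-space
`{x | m ≤ x₂}`.** On the full-measure set where `ω` opens only lattice edges (`ae_subset_edgeSet`)
and no `y` percolates inside `{x | y₂ ≤ x₂}` (countably many null events,
`tROC_real_percolatesVia_halfSpace_eq_zero`): a confined cluster has a lowest vertex `y`
(`Int.exists_least_of_bdd`), `C(y) = C(b) ⊆ {x | y₂ ≤ x₂}`, so `C(b)` is reached from `y` inside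
that half-space (`tROC_openCluster_subset_openClusterIn`) and would percolate there if infinite. -/
theorem tROC_ae_finite_of_subset_halfSpace :
    ∀ᵐ ω ∂(bondPercolation (zdGraph 3) (criticalProbI 3)), ∀ (b : Site 3) (m : ℤ),
      openCluster ω b ⊆ {x : Site 3 | m ≤ x 2} → (openCluster ω b).Finite := by
  have hae : ∀ᵐ ω ∂(bondPercolation (zdGraph 3) (criticalProbI 3)), ω ⊆ (zdGraph 3).edgeSet :=
    ae_subset_edgeSet (zdGraph 3) (criticalProbI 3)
  have hnull : ∀ᵐ ω ∂(bondPercolation (zdGraph 3) (criticalProbI 3)), ∀ y : Site 3,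
      ω ∉ percolatesVia (withinGraph (zdGraph 3) {x : Site 3 | y 2 ≤ x 2}) y := by
    rw [ae_all_iff]
    intro y
    exact measure_eq_zero_iff_ae_notMem.1
      ((measureReal_eq_zero_iff (measure_ne_top _ _)).1
        (tROC_real_percolatesVia_halfSpace_eq_zero y))
  filter_upwards [hae, hnull] with ω hω hω' b m hsub
  by_contra hinf
  -- the lowest vertex `y` of the confined cluster
  obtain ⟨n, ⟨y, hy, rfl⟩, hmin⟩ :=
    Int.exists_least_of_bdd (P := fun n : ℤ => ∃ z ∈ openCluster ω b, z 2 = n)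
      ⟨m, by
        rintro n ⟨z, hz, rfl⟩
        exact hsub hz⟩
      ⟨b 2, b, mem_openCluster_self ω b, rfl⟩
  -- `C(y) = C(b)`
  have hyb : openCluster ω y = openCluster ω b := by
    ext z
    exact ⟨fun hz => (show (openGraph ω).Reachable b y from hy).trans hz,
      fun hz => (show (openGraph ω).Reachable b y from hy).symm.trans hz⟩
  have hW : openCluster ω y ⊆ {x : Site 3 | y 2 ≤ x 2} := by
    intro z hz
    rw [hyb] at hz
    exact hmin (z 2) ⟨z, hz, rfl⟩
  refine hω' y ?_
  change (openClusterIn (withinGraph (zdGraph 3) {x : Site 3 | y 2 ≤ x 2}) ω y).Infinite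
  refine Set.Infinite.mono (tROC_openCluster_subset_openClusterIn hω hW) ?_
  rw [hyb]
  exact hinf

/-- Hence intersecting an event that confines `C(b)` to an upper half-space with `{C(b) finite}`
does not change its probability at `p_c`. -/
theorem tROC_real_inter_finite (b : Site 3) (m : ℤ) {A : Set (BondConfig (Site 3))}
    (hA : A ⊆ {ω | openCluster ω b ⊆ {x : Site 3 | m ≤ x 2}}) :
    (bondPercolation (zdGraph 3) (criticalProbI 3)).real
        (A ∩ {ω | (openCluster ω b).Finite}) =
      (bondPercolation (zdGraph 3) (criticalProbI 3)).real A := by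
  refine measureReal_congr ?_
  filter_upwards [tROC_ae_finite_of_subset_halfSpace] with ω hω
  refine propext ?_
  change ω ∈ A ∩ {ω | (openCluster ω b).Finite} ↔ ω ∈ A
  exact ⟨fun h => h.1, fun h => ⟨h, hω b m (hA h)⟩⟩

/-- **Abstract squaring step.** If `CH ×ˢ (CU ∩ F) ⊆ E`, `P(CU ∩ F) = P(CU) = P(CH)`, `τ_b = τ_a`
and `0 ≤ c τ_a ≤ P(CH)`, then `c² τ_a τ_b ≤ (P ⊗ P)(E)` (`measureReal_prod_prod`). -/
theorem tROC_assemble {Ω : Type*} [MeasurableSpace Ω] (P : Measure Ω) [IsProbabilityMeasure P]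
    (CH CU F : Set Ω) {E : Set (Ω × Ω)} {c τa τb : ℝ}
    (hsub : CH ×ˢ (CU ∩ F) ⊆ E) (hF : P.real (CU ∩ F) = P.real CU)
    (hsymm : P.real CU = P.real CH) (hτ : τb = τa) (hc : 0 ≤ c * τa) (h : c * τa ≤ P.real CH) :
    c ^ 2 * τa * τb ≤ (P.prod P).real E :=
  calc c ^ 2 * τa * τb = (c * τa) * (c * τa) := by rw [hτ]; ring
    _ ≤ P.real CH * P.real CH := mul_le_mul h h hc measureReal_nonneg
    _ = P.real CH * P.real (CU ∩ F) := by rw [hF, hsymm]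
    _ = (P.prod P).real (CH ×ˢ (CU ∩ F)) := (measureReal_prod_prod _ _).symm
    _ ≤ (P.prod P).real E := measureReal_mono hsub

/-- **S8 — confinement positivity implies two-replica non-intersection, `q = c²`.** With
`a_r = (r,r,0)`, `b_r = (r,0,r)`, `c_r = (0,r,r)`, `H_r = {x | 2x₂ + 2 ≤ r}`, `U_r = {x | r + 2 ≤ 2x₂}`
and `P = bondPercolation (zdGraph 3) p_c`: if `c τ(0, a_r) ≤ P(a_r ∈ C(0) ⊆ H_r)` for `r ≥ r₀`, then
`c² τ(0, a_r) τ(b_r, c_r) ≤ (P ⊗ P){a_r ∈ C₁(0), c_r ∈ C₂(b_r), C₂(b_r) finite, C₁(0) ∩ C₂(b_r) = ∅}`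
for `r ≥ r₀`. The rectangle `Conf(H_r; 0, a_r) ×ˢ (Conf(U_r; b_r, c_r) ∩ {C(b_r) finite})` lies in the
event (`H_r ∩ U_r = ∅`), has probability `P(Conf_H) · P(Conf_U ∩ Fin)` (`measureReal_prod_prod`),
the finiteness conjunct is almost sure (no infinite cluster confined to a half-space at `p_c`,
Barsky–Grimmett–Newman, `tROC_real_inter_finite`), and `P(Conf_U) = P(Conf_H)`,
`τ(b_r, c_r) = τ(0, a_r)` by the pair symmetry `stub_pairSymm`. -/
theorem stub_twoReplicaOfConfinement
    (hConf : ∃ c : ℝ, 0 < c ∧ ∃ r₀ : ℕ, ∀ r : ℕ, r₀ ≤ r →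
      c * tau 3 (criticalProbI 3) 0 ![(r : ℤ), (r : ℤ), 0] ≤
        (bondPercolation (zdGraph 3) (criticalProbI 3)).real
          {ω | (![(r : ℤ), (r : ℤ), 0] : Site 3) ∈ openCluster ω 0 ∧
            openCluster ω 0 ⊆ {x | 2 * x 2 + 2 ≤ (r : ℤ)}}) :
    ∃ q : ℝ, 0 < q ∧ ∃ r₀ : ℕ, ∀ r : ℕ, r₀ ≤ r →
      q * tau 3 (criticalProbI 3) 0 ![(r : ℤ), (r : ℤ), 0] *
          tau 3 (criticalProbI 3) ![(r : ℤ), 0, (r : ℤ)] ![0, (r : ℤ), (r : ℤ)] ≤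
        ((bondPercolation (zdGraph 3) (criticalProbI 3)).prod
            (bondPercolation (zdGraph 3) (criticalProbI 3))).real
          {q : BondConfig (Site 3) × BondConfig (Site 3) |
            (![(r : ℤ), (r : ℤ), 0] : Site 3) ∈ openCluster q.1 0 ∧
              (![0, (r : ℤ), (r : ℤ)] : Site 3) ∈ openCluster q.2 ![(r : ℤ), 0, (r : ℤ)] ∧
              (openCluster q.2 (![(r : ℤ), 0, (r : ℤ)] : Site 3)).Finite ∧
              Disjoint (openCluster q.1 (0 : Site 3)) (openCluster q.2 ![(r : ℤ), 0, (r : ℤ)])} := by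
  obtain ⟨c, hc, r₀, hr⟩ := hConf
  refine ⟨c ^ 2, by positivity, r₀, fun r hrr => ?_⟩
  obtain ⟨hτ, hsymm⟩ := stub_pairSymm (criticalProbI 3) r
  refine tROC_assemble (bondPercolation (zdGraph 3) (criticalProbI 3))
    {ω | (![(r : ℤ), (r : ℤ), 0] : Site 3) ∈ openCluster ω 0 ∧
      openCluster ω 0 ⊆ {x | 2 * x 2 + 2 ≤ (r : ℤ)}}
    {ω | (![0, (r : ℤ), (r : ℤ)] : Site 3) ∈ openCluster ω ![(r : ℤ), 0, (r : ℤ)] ∧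
      openCluster ω ![(r : ℤ), 0, (r : ℤ)] ⊆ {x | (r : ℤ) + 2 ≤ 2 * x 2}}
    {ω | (openCluster ω (![(r : ℤ), 0, (r : ℤ)] : Site 3)).Finite}
    ?_ ?_ hsymm ?_ (mul_nonneg hc.le (tau_nonneg _ _ _)) (hr r hrr)
  · -- the rectangle lies in the two-replica event: `H_r ∩ U_r = ∅`
    rintro ⟨ω₁, ω₂⟩ ⟨⟨ha, hH⟩, ⟨hc₂, hU⟩, hfin⟩
    refine ⟨ha, hc₂, hfin, Set.disjoint_left.2 ?_⟩
    intro z hz₁ hz₂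
    have h₁ := hH hz₁
    have h₂ := hU hz₂
    simp only [Set.mem_setOf_eq] at h₁ h₂
    omega
  · -- the finiteness conjunct is almost sure (`U_r ⊆ {x | 1 ≤ x₂}`)
    exact tROC_real_inter_finite _ 1 fun ω hω z hz => by
      have h₂ := hω.2 hz
      simp only [Set.mem_setOf_eq] at h₂ ⊢
      omega
  · -- `τ(b_r, c_r) = τ(0, a_r)`
    rw [tau_def, tau_def]
    exact hτ

end Summit.CriticalPhenomena.PercolationContinuityZ3.Theorems.TetrahedronDisjointCoexistence

end
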